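import Mathlib
import HarnessLib

/-!
# Dimock, *Quantum electrodynamics on the 3-torus II*, §3.1 (124)–(125): «First take a smooth function `g` on `ℝ³` so
# `g` has support in `{x : |x| ≤ 2∕3}` and `g = 1` on `{x : |x| ≤ 1∕3}` and `Σ_{n∈ℤ³} g(x − n)² = 1`» — such a `g` EXISTS
# (CONSTRUCTED, every dimension, sup norm), and its rescaled translates `h_□(x) = g((x − y)L^{k−i}∕M₀)` (124) satisfy
# `Σ_□ h_□(x)² = 1` (125) on a single scale — PROVED

statement-level skeleton of published theorems with citation tags; proofs where landed; nothing here is a claim about the Yang–Mills mass gap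

**Citation header (reproduction of PUBLISHED work).** J. Dimock, *Quantum electrodynamics on the 3-torus. II. The
renormalization group flow*, arXiv:math-ph/0407063 (2004) [Dimock2004QED3TorusII], §3.1 «definitions», p.20 L82 – p.21
L10 of the held arXiv-v1 text layer `paper:arxiv-math-ph_0407063` (`p.NN Lnn` = PDF page ∕ text-layer line); the sup metric
`|x − y| = sup_μ|x_μ − y_μ|` is paper I's, arXiv:math-ph/0210020 [Dimock2002QED3TorusI], (21) p.9 L38–42.  Writer seat p11
(literature-prover-lit-balaban-p11-g23-0), YM LIT SWEEP item (c) D13 (row C13; zero weight for the YM-INPRINT tokens).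
Companion of the tree's `QED3CommutatorBounds.lean` (which takes `g` as «a differentiable `g` with `‖g′‖ ≤ G`») and
`QED3WalkExpansionInverse.lean` (which takes (125) as the hypothesis `Σ_□ h_□² = 1`): this file supplies the EXISTENCE of
the printed `g`.

**The printed text (p.20 L82 – p.21 L10).** *"We will need partitions of unity concentrated on the sets `□ ∈ D`. First
take a smooth function `g` on `ℝ³` so `g` has support in `{x : |x| ≤ 2∕3}` and `g = 1` on `{x : |x| ≤ 1∕3}` and
`Σ_{n∈ℤ³} g(x − n)² = 1`. Then if `□` is a `D_i` block in the interior of `⋃_{□∈D_i}□` centered on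
`y ∈ T^{−(k−i)+m_0}_{N+M−k}`, we define `h_□(x) = g((x − y)L^{k−i}∕M₀)` (124) Then for `x` well inside `⋃_{□∈D_i}□`
`Σ_{□∈D} h_□(x)² = 1` (125) For `□ ∈ D_i` blocks touching `D_{i−1}` blocks the scalings do not match. We require in this
case that the definition of `h_□(x)` be modified on any boundary face … Then (125) holds for all `x ∈ L^{−k}Λ_0`. Note
that `h_□h_□′ = 0` unless `□, □′` touch."*

**What is formalized (all PROVED; no named facts, no `sorry`).**  The paper asserts the existence of `g` without
construction; here it is CONSTRUCTED (the standard `η∕√(Ση²)` device) in every dimension for the sup norm of paper I: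
* §1 dimension one — `bump : ContDiffBump (0 : ℝ)` with radii `r_in = 1∕2 < r_out = 3∕5` (Mathlib's smooth bump: `= 1`
  on `|t| ≤ 1∕2`, `= 0` on `|t| ≥ 3∕5`, values in `[0,1]`); `periodization t = Σ_{n ∈ {⌊t⌋, ⌊t⌋+1}} bump(t − n)²` — the only
  translates that can be non-zero (`bump_sub_eq_zero_of_not_mem_near`), so this IS `Σ_{n∈ℤ} bump(t − n)²`
  (`hasSum_bump_sq`); `one_le_periodization` (the translate by `round t` contributes `1`), `periodization_sub_intCast`
  (`1`-periodicity), `contDiff_periodization` (near every `t₀` it is a FIXED finite sum of smooth functions: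
  `periodization_eq_sum_window`); **`g₁ t = bump t ∕ √(periodization t)`**: `contDiff_g₁` (smooth), `g₁_eq_zero`
  (`|t| ≥ 3∕5 ⟹ g₁ t = 0`, so `supp g₁ ⊂ {|t| ≤ 2∕3}`), `g₁_eq_one` (`|t| ≤ 1∕3 ⟹ g₁ t = 1`), `g₁_nonneg`, `g₁_le_one`,
  and **`hasSum_g₁_sq`: `Σ_{n∈ℤ} g₁(t − n)² = 1`** (`tsum_g₁_sq`).
* §2 dimension `|ι|` (the paper: `ι = Fin 3`), sup norm `‖x‖ = sup_μ|x_μ|` (Mathlib's norm on `ι → ℝ`) —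
  **`g x = Π_μ g₁(x_μ)`**: `contDiff_g` (*"smooth"*), **`g_eq_zero`** (`‖x‖ > 2∕3 ⟹ g x = 0` — indeed already for some
  `|x_μ| ≥ 3∕5`: *"support in `{x : |x| ≤ 2∕3}`"*), **`g_eq_one`** (*"`g = 1` on `{x : |x| ≤ 1∕3}`"*), `g_nonneg`, `g_le_one`,
  and **`hasSum_g_sq` ∕ `tsum_g_sq`: `Σ_{n∈ℤ^ι} g(x − n)² = 1`** — the three printed properties; `hasCompactSupport_g`,
  `exists_fderiv_g_le` (a bound `‖g′‖ ≤ G`, the input of the tree's `QED3CommutatorBounds`); `exists_dimock124` packages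
  them as the existence statement of the paper.
* §3 (124)–(125) single scale — `hBlock s y x = g(s•(x − y))` (`s = L^{k−i}∕M₀`, `y` the centre) and **`eq125`**: for the
  blocks of ONE scale centred on the lattice `s^{−1}(y₀ + ℤ^ι)`, `Σ_{n∈ℤ^ι} hBlock s (y₀ + s^{−1}n) x ² = 1` for every `x`
  (*"for `x` well inside `⋃_{□∈D_i}□`"* — where only one scale is seen).

**Honest scope.** The radii `1∕2, 3∕5` are a choice (any `1∕2 ≤ r_in < r_out ≤ 2∕3` works: translates of `[−1∕2,1∕2]`
must cover `ℝ`, and supports must stay inside `2∕3` so that `g = 1` on `|x| ≤ 1∕3`); the paper fixes no formula.  NOT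
here: the boundary modification of `h_□` between scales (*"the scalings do not match … modified on any boundary face"*)
and (125) on all of `L^{−k}Λ_0` for the multiscale family `D`; «`h_□h_□′ = 0` unless `□, □′` touch» (immediate from
the supports, not restated); the derivative bound `sup|∂h_□| ≤ O(L^{k−i}∕M₀)` used in (145)∕(150) (the tree's
`QED3CommutatorBounds` takes `‖g′‖ ≤ G` as its input; a bound `G` for this `g` is shown to EXIST, `exists_fderiv_g_le`, but
is not computed).  No `d = 4` statement; nothing about Bałaban's papers.
-/

noncomputable section

namespace Literature.MathematicalPhysics.QuantumFieldTheory.Dimock2011to13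

namespace QED3SquarePartition

open Finset Metric

/-! ## §1 Dimension one -/

/-- the smooth bump on `ℝ`: `= 1` on `|t| ≤ 1∕2`, `= 0` on `|t| ≥ 3∕5`, smooth, values in `[0,1]` (Mathlib's `ContDiffBump`).
[cite: Dimock2004QED3TorusII, §3.1 p.20 L82–84 («take a smooth function g»)] -/
def bump : ContDiffBump (0 : ℝ) := ⟨1 / 2, 3 / 5, by norm_num, by norm_num⟩

/-- `bump t = 1` for `|t| ≤ 1∕2`. [cite: Dimock2004QED3TorusII, §3.1 p.20 L82–84] -/
theorem bump_eq_one {t : ℝ} (ht : |t| ≤ 1 / 2) : bump t = 1 := by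
  apply bump.one_of_mem_closedBall
  rw [mem_closedBall, Real.dist_eq, sub_zero]
  exact ht

/-- `bump t = 0` for `|t| ≥ 3∕5`. [cite: Dimock2004QED3TorusII, §3.1 p.20 L82–84] -/
theorem bump_eq_zero {t : ℝ} (ht : 3 / 5 ≤ |t|) : bump t = 0 := by
  apply bump.zero_of_le_dist
  rw [Real.dist_eq, sub_zero]
  exact ht

/-- if `bump t ≠ 0` then `|t| < 3∕5`. [cite: Dimock2004QED3TorusII, §3.1 p.20 L82–84] -/
theorem abs_lt_of_bump_ne_zero {t : ℝ} (ht : bump t ≠ 0) : |t| < 3 / 5 := by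
  by_contra h
  exact ht (bump_eq_zero (not_lt.1 h))

/-- the two integers nearest to `t` from below and above: `{⌊t⌋, ⌊t⌋ + 1}` — the only `n ∈ ℤ` with `|t − n| < 1`.
[cite: Dimock2004QED3TorusII, §3.1 p.20 L82–84 («Σ_{n∈ℤ³} g(x − n)² = 1»)] -/
def near (t : ℝ) : Finset ℤ := {⌊t⌋, ⌊t⌋ + 1}

/-- an integer at distance `< 1` from `t` is `⌊t⌋` or `⌊t⌋ + 1`. [cite: Dimock2004QED3TorusII, §3.1 p.20 L82–84] -/
theorem mem_near_of_abs_lt_one {t : ℝ} {n : ℤ} (h : |t - n| < 1) : n ∈ near t := by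
  rw [abs_lt] at h
  have h1 : (⌊t⌋ : ℝ) ≤ t := Int.floor_le t
  have h2 : t < ⌊t⌋ + 1 := Int.lt_floor_add_one t
  have h3 : ((⌊t⌋ - 1 : ℤ) : ℝ) < n := by push_cast; linarith
  have h4 : (n : ℝ) < ((⌊t⌋ + 2 : ℤ) : ℝ) := by push_cast; linarith
  have h3' := Int.cast_lt.1 h3
  have h4' := Int.cast_lt.1 h4
  rw [near, mem_insert, mem_singleton]
  omega

/-- a translate `bump(t − n)` that does not vanish has `n ∈ near t`. [cite: Dimock2004QED3TorusII, §3.1 p.20 L82–84] -/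
theorem mem_near_of_bump_ne_zero {t : ℝ} {n : ℤ} (h : bump (t - n) ≠ 0) : n ∈ near t :=
  mem_near_of_abs_lt_one ((abs_lt_of_bump_ne_zero h).trans (by norm_num))

/-- contrapositive: outside `near t` the translates vanish. [cite: Dimock2004QED3TorusII, §3.1 p.20 L82–84] -/
theorem bump_sub_eq_zero_of_not_mem_near {t : ℝ} {n : ℤ} (h : n ∉ near t) : bump (t - n) = 0 := by
  by_contra h'
  exact h (mem_near_of_bump_ne_zero h')

/-- **the periodization `S(t) = Σ_{n∈ℤ} bump(t − n)²`**, written as the finite sum over `near t` (all other terms vanish).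
[cite: Dimock2004QED3TorusII, §3.1 p.20 L82–84] -/
def periodization (t : ℝ) : ℝ := ∑ n ∈ near t, bump (t - n) ^ 2

/-- the periodization over any finite set of integers containing `near t`. [cite: Dimock2004QED3TorusII, §3.1 p.20 L82–84] -/
theorem periodization_eq_sum_of_subset {t : ℝ} {F : Finset ℤ} (hF : near t ⊆ F) :
    periodization t = ∑ n ∈ F, bump (t - n) ^ 2 := by
  rw [periodization]
  refine (sum_subset hF fun n _ hn => ?_)
  rw [bump_sub_eq_zero_of_not_mem_near hn, zero_pow two_ne_zero]

/-- `S(t) = Σ_{n∈ℤ} bump(t − n)²` as an unconditional sum over `ℤ`. [cite: Dimock2004QED3TorusII, §3.1 p.20 L82–84] -/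
theorem hasSum_bump_sq (t : ℝ) : HasSum (fun n : ℤ => bump (t - n) ^ 2) (periodization t) := by
  rw [periodization]
  exact hasSum_sum_of_ne_finset_zero fun n hn => by
    rw [bump_sub_eq_zero_of_not_mem_near hn, zero_pow two_ne_zero]

/-- `S(t) ≥ 1`: the translate by `round t` (`|t − round t| ≤ 1∕2`) contributes `1`. [cite: Dimock2004QED3TorusII, §3.1 p.20 L82–84] -/
theorem one_le_periodization (t : ℝ) : 1 ≤ periodization t := by
  have hr : |t - round t| ≤ 1 / 2 := abs_sub_round t
  have hmem : round t ∈ near t := mem_near_of_abs_lt_one (hr.trans_lt (by norm_num))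
  have h1 : bump (t - round t) ^ 2 = 1 := by rw [bump_eq_one hr, one_pow]
  rw [periodization, ← h1]
  exact single_le_sum (f := fun n : ℤ => bump (t - n) ^ 2) (fun n _ => sq_nonneg _) hmem

/-- `S(t) > 0`. [cite: Dimock2004QED3TorusII, §3.1 p.20 L82–84] -/
theorem periodization_pos (t : ℝ) : 0 < periodization t :=
  zero_lt_one.trans_le (one_le_periodization t)

/-- **periodicity**: `S(t − m) = S(t)` for `m ∈ ℤ`. [cite: Dimock2004QED3TorusII, §3.1 p.20 L82–84] -/
theorem periodization_sub_intCast (t : ℝ) (m : ℤ) : periodization (t - m) = periodization t := by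
  have h1 := hasSum_bump_sq (t - m)
  have h2 : HasSum (fun n : ℤ => bump (t - m - n) ^ 2) (periodization t) := by
    have e : (fun n : ℤ => bump (t - m - n) ^ 2) = (fun n : ℤ => bump (t - n) ^ 2) ∘ (fun n : ℤ => m + n) := by
      funext n
      simp only [Function.comp_apply, Int.cast_add]
      ring_nf
    rw [e]
    exact (Equiv.addLeft m).hasSum_iff.2 (hasSum_bump_sq t)
  exact h1.unique h2

/-- near `t₀` the periodization is ONE fixed finite sum: for `|t − t₀| < 1`,
`S(t) = Σ_{n ∈ {⌊t₀⌋−1, ⌊t₀⌋, ⌊t₀⌋+1, ⌊t₀⌋+2}} bump(t − n)²`. [cite: Dimock2004QED3TorusII, §3.1 p.20 L82–84] -/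
theorem periodization_eq_sum_window {t₀ t : ℝ} (h : |t - t₀| < 1) :
    periodization t = ∑ n ∈ ({⌊t₀⌋ - 1, ⌊t₀⌋, ⌊t₀⌋ + 1, ⌊t₀⌋ + 2} : Finset ℤ), bump (t - n) ^ 2 := by
  apply periodization_eq_sum_of_subset
  intro n hn
  rw [near, mem_insert, mem_singleton] at hn
  rw [abs_lt] at h
  have h1 : (⌊t⌋ : ℝ) ≤ t := Int.floor_le t
  have h2 : t < ⌊t⌋ + 1 := Int.lt_floor_add_one t
  have h3 : (⌊t₀⌋ : ℝ) ≤ t₀ := Int.floor_le t₀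
  have h4 : t₀ < ⌊t₀⌋ + 1 := Int.lt_floor_add_one t₀
  have h5 : ((⌊t₀⌋ - 2 : ℤ) : ℝ) < ⌊t⌋ := by push_cast; linarith
  have h6 : ((⌊t⌋ : ℤ) : ℝ) < ((⌊t₀⌋ + 2 : ℤ) : ℝ) := by push_cast; linarith
  have h5' := Int.cast_lt.1 h5
  have h6' := Int.cast_lt.1 h6
  simp only [mem_insert, mem_singleton]
  omega

/-- **the periodization is smooth** (locally a finite sum of smooth functions).
[cite: Dimock2004QED3TorusII, §3.1 p.20 L82–84 («a smooth function g»)] -/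
theorem contDiff_periodization {m : ℕ∞} : ContDiff ℝ m periodization := by
  rw [contDiff_iff_contDiffAt]
  intro t₀
  have hsmooth : ContDiff ℝ m fun t : ℝ =>
      ∑ n ∈ ({⌊t₀⌋ - 1, ⌊t₀⌋, ⌊t₀⌋ + 1, ⌊t₀⌋ + 2} : Finset ℤ), bump (t - n) ^ 2 :=
    ContDiff.sum fun n _ => (bump.contDiff.comp (contDiff_id.sub contDiff_const)).pow 2
  refine hsmooth.contDiffAt.congr_of_eventuallyEq ?_
  filter_upwards [Metric.ball_mem_nhds t₀ zero_lt_one] with t ht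
  rw [mem_ball, Real.dist_eq] at ht
  exact periodization_eq_sum_window ht

/-- **`g₁ = bump ∕ √S`** — the one-dimensional square-root partition of unity. [cite: Dimock2004QED3TorusII, §3.1 p.20 L82–84] -/
def g₁ (t : ℝ) : ℝ := bump t / Real.sqrt (periodization t)

/-- `g₁` is smooth. [cite: Dimock2004QED3TorusII, §3.1 p.20 L82–84 («a smooth function g»)] -/
theorem contDiff_g₁ {m : ℕ∞} : ContDiff ℝ m g₁ := by
  have h1 : ContDiff ℝ m fun t => Real.sqrt (periodization t) :=
    contDiff_periodization.sqrt fun t => (periodization_pos t).ne'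
  have h2 : ContDiff ℝ m ((fun t => bump t) / fun t => Real.sqrt (periodization t)) :=
    bump.contDiff.div h1 fun t => (Real.sqrt_pos.2 (periodization_pos t)).ne'
  exact h2

/-- `g₁ t = 0` for `|t| ≥ 3∕5` — so `supp g₁ ⊂ {|t| ≤ 2∕3}`. [cite: Dimock2004QED3TorusII, §3.1 p.20 L82–84 («support in {x : |x| ≤ 2/3}»)] -/
theorem g₁_eq_zero {t : ℝ} (ht : 3 / 5 ≤ |t|) : g₁ t = 0 := by
  rw [g₁, bump_eq_zero ht, zero_div]

/-- `g₁ t = 1` for `|t| ≤ 1∕3` (there `bump t = 1` and no other translate is seen: `S(t) = 1`).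
[cite: Dimock2004QED3TorusII, §3.1 p.20 L82–84 («g = 1 on {x : |x| ≤ 1/3}»)] -/
theorem g₁_eq_one {t : ℝ} (ht : |t| ≤ 1 / 3) : g₁ t = 1 := by
  have hb : bump t = 1 := bump_eq_one (ht.trans (by norm_num))
  have hS : periodization t = 1 := by
    have h0 : near t ⊆ ({0, ⌊t⌋, ⌊t⌋ + 1} : Finset ℤ) := by
      intro n hn; rw [near, mem_insert, mem_singleton] at hn
      simp only [mem_insert, mem_singleton]; omega
    rw [periodization_eq_sum_of_subset h0, sum_eq_single (0 : ℤ)]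
    · simp [hb]
    · intro n _ hn
      have : bump (t - n) = 0 := by
        apply bump_eq_zero
        have h1 : (1 : ℝ) ≤ |(n : ℝ)| := by
          rw [← Int.cast_abs]; exact_mod_cast Int.one_le_abs hn
        have h2 : |(n : ℝ)| - |t| ≤ |t - n| := by
          have := abs_sub_abs_le_abs_sub (n : ℝ) t
          rwa [abs_sub_comm] at this
        linarith
      rw [this, zero_pow two_ne_zero]
    · intro h; exact absurd (mem_insert_self _ _) h
  rw [g₁, hb, hS, Real.sqrt_one, div_one]

/-- `0 ≤ g₁`. [cite: Dimock2004QED3TorusII, §3.1 p.20 L82–84] -/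
theorem g₁_nonneg (t : ℝ) : 0 ≤ g₁ t :=
  div_nonneg bump.nonneg (Real.sqrt_nonneg _)

/-- `g₁ ≤ 1` (`bump ≤ 1 ≤ √S`). [cite: Dimock2004QED3TorusII, §3.1 p.20 L82–84] -/
theorem g₁_le_one (t : ℝ) : g₁ t ≤ 1 := by
  rw [g₁, div_le_one (Real.sqrt_pos.2 (periodization_pos t))]
  exact bump.le_one.trans (Real.one_le_sqrt.2 (one_le_periodization t))

/-- the squares of the translates: `g₁(t − n)² = bump(t − n)² ∕ S(t)` (periodicity of `S`).
[cite: Dimock2004QED3TorusII, §3.1 p.20 L82–84] -/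
theorem g₁_sub_sq (t : ℝ) (n : ℤ) : g₁ (t - n) ^ 2 = bump (t - n) ^ 2 / periodization t := by
  rw [g₁, div_pow, Real.sq_sqrt (periodization_pos _).le, periodization_sub_intCast]

/-- **`Σ_{n∈ℤ} g₁(t − n)² = 1`** in dimension one. [cite: Dimock2004QED3TorusII, §3.1 p.20 L82–84 («Σ_{n∈ℤ³} g(x − n)² = 1»)] -/
theorem hasSum_g₁_sq (t : ℝ) : HasSum (fun n : ℤ => g₁ (t - n) ^ 2) 1 := by
  simp_rw [g₁_sub_sq]
  have h := (hasSum_bump_sq t).div_const (periodization t)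
  rwa [div_self (periodization_pos t).ne'] at h

/-- `Σ'_{n∈ℤ} g₁(t − n)² = 1`. [cite: Dimock2004QED3TorusII, §3.1 p.20 L82–84] -/
theorem tsum_g₁_sq (t : ℝ) : ∑' n : ℤ, g₁ (t - n) ^ 2 = 1 := (hasSum_g₁_sq t).tsum_eq

/-- the finite form: `Σ_{n ∈ near t} g₁(t − n)² = 1`, all other translates vanishing.
[cite: Dimock2004QED3TorusII, §3.1 p.20 L82–84] -/
theorem sum_near_g₁_sq (t : ℝ) : ∑ n ∈ near t, g₁ (t - n) ^ 2 = 1 := by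
  have h : HasSum (fun n : ℤ => g₁ (t - n) ^ 2) (∑ n ∈ near t, g₁ (t - n) ^ 2) :=
    hasSum_sum_of_ne_finset_zero fun n hn => by
      rw [g₁, bump_sub_eq_zero_of_not_mem_near hn, zero_div, zero_pow two_ne_zero]
  exact h.unique (hasSum_g₁_sq t)

/-- a non-vanishing translate `g₁(t − n)` has `n ∈ near t`. [cite: Dimock2004QED3TorusII, §3.1 p.20 L82–84] -/
theorem g₁_sub_eq_zero_of_not_mem_near {t : ℝ} {n : ℤ} (h : n ∉ near t) : g₁ (t - n) = 0 := by
  rw [g₁, bump_sub_eq_zero_of_not_mem_near h, zero_div]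

/-! ## §2 Dimension `|ι|`, sup norm -/

section Product

variable {ι : Type*} [Fintype ι]

/-- **`g(x) = Π_μ g₁(x_μ)`** on `ℝ^ι` (the paper: `ι = Fin 3`). [cite: Dimock2004QED3TorusII, §3.1 p.20 L82–84] -/
def g (x : ι → ℝ) : ℝ := ∏ μ, g₁ (x μ)

/-- **`g` is smooth.** [cite: Dimock2004QED3TorusII, §3.1 p.20 L82–84 («a smooth function g on ℝ³»)] -/
theorem contDiff_g {m : ℕ∞} : ContDiff ℝ m (g : (ι → ℝ) → ℝ) :=
  contDiff_prod fun μ _ => contDiff_g₁.comp (contDiff_apply ℝ ℝ μ)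

/-- `0 ≤ g ≤ 1`. [cite: Dimock2004QED3TorusII, §3.1 p.20 L82–84] -/
theorem g_nonneg (x : ι → ℝ) : 0 ≤ g x := prod_nonneg fun _ _ => g₁_nonneg _

/-- `g ≤ 1`. [cite: Dimock2004QED3TorusII, §3.1 p.20 L82–84] -/
theorem g_le_one (x : ι → ℝ) : g x ≤ 1 := prod_le_one (fun _ _ => g₁_nonneg _) fun _ _ => g₁_le_one _

/-- `g x = 0` as soon as one coordinate has `|x_μ| ≥ 3∕5`. [cite: Dimock2004QED3TorusII, §3.1 p.20 L82–84] -/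
theorem g_eq_zero_of_coord {x : ι → ℝ} {μ : ι} (h : 3 / 5 ≤ |x μ|) : g x = 0 :=
  prod_eq_zero (mem_univ μ) (g₁_eq_zero h)

/-- **«support in `{x : |x| ≤ 2∕3}`»** (sup norm): `‖x‖ > 2∕3 ⟹ g x = 0` (indeed already for `‖x‖ ≥ 3∕5`).
[cite: Dimock2004QED3TorusII, §3.1 p.20 L82–84; Dimock2002QED3TorusI, (21) p.9 L38–42 («|x − y| = sup_μ|x_μ − y_μ|»)] -/
theorem g_eq_zero {x : ι → ℝ} (h : 2 / 3 < ‖x‖) : g x = 0 := by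
  have h' : 3 / 5 < ‖x‖ := lt_trans (by norm_num) h
  obtain ⟨μ, hμ⟩ : ∃ μ, 3 / 5 < |x μ| := by
    by_contra hcon
    push Not at hcon
    have : ‖x‖ ≤ 3 / 5 := (pi_norm_le_iff_of_nonneg (by norm_num)).2 fun μ => by
      rw [Real.norm_eq_abs]; exact hcon μ
    linarith
  exact g_eq_zero_of_coord hμ.le

/-- **«`g = 1` on `{x : |x| ≤ 1∕3}`»** (sup norm). [cite: Dimock2004QED3TorusII, §3.1 p.20 L82–84] -/
theorem g_eq_one {x : ι → ℝ} (h : ‖x‖ ≤ 1 / 3) : g x = 1 := by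
  apply prod_eq_one
  intro μ _
  apply g₁_eq_one
  have := norm_le_pi_norm x μ
  rw [Real.norm_eq_abs] at this
  exact this.trans h

/-- the translates that can be seen at `x`: `n ∈ Π_μ near(x_μ)`; all others give `g(x − n) = 0`.
[cite: Dimock2004QED3TorusII, §3.1 p.20 L82–84] -/
theorem g_sub_eq_zero_of_not_mem [DecidableEq ι] {x : ι → ℝ} {n : ι → ℤ}
    (h : n ∉ Fintype.piFinset fun μ => near (x μ)) : g (x - fun μ => (n μ : ℝ)) = 0 := by
  rw [Fintype.mem_piFinset] at h
  push Not at h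
  obtain ⟨μ, hμ⟩ := h
  apply prod_eq_zero (mem_univ μ)
  exact g₁_sub_eq_zero_of_not_mem_near hμ

/-- **«`Σ_{n∈ℤ³} g(x − n)² = 1`»** — as the finite sum over the visible translates: `Π_μ Σ_{n_μ} g₁(x_μ − n_μ)² = 1`.
[cite: Dimock2004QED3TorusII, §3.1 p.20 L82–84] -/
theorem sum_g_sq [DecidableEq ι] (x : ι → ℝ) :
    ∑ n ∈ Fintype.piFinset (fun μ => near (x μ)), g (x - fun μ => (n μ : ℝ)) ^ 2 = 1 := by
  have h : ∀ n : ι → ℤ, g (x - fun μ => (n μ : ℝ)) ^ 2 = ∏ μ, g₁ (x μ - n μ) ^ 2 := by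
    intro n
    rw [g, ← prod_pow]
    rfl
  simp_rw [h]
  rw [show (∑ n ∈ Fintype.piFinset (fun μ => near (x μ)), ∏ μ, g₁ (x μ - (n μ : ℝ)) ^ 2)
      = ∏ μ, ∑ a ∈ near (x μ), g₁ (x μ - (a : ℝ)) ^ 2 from
    (prod_univ_sum (fun μ => near (x μ)) (fun μ (a : ℤ) => g₁ (x μ - (a : ℝ)) ^ 2)).symm]
  exact prod_eq_one fun μ _ => sum_near_g₁_sq (x μ)

/-- **«`Σ_{n∈ℤ³} g(x − n)² = 1`»** as an unconditional sum over `ℤ^ι`. [cite: Dimock2004QED3TorusII, §3.1 p.20 L82–84] -/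
theorem hasSum_g_sq (x : ι → ℝ) : HasSum (fun n : ι → ℤ => g (x - fun μ => (n μ : ℝ)) ^ 2) 1 := by
  classical
  rw [← sum_g_sq x]
  exact hasSum_sum_of_ne_finset_zero fun n hn => by
    rw [g_sub_eq_zero_of_not_mem hn, zero_pow two_ne_zero]

/-- `Σ'_{n∈ℤ^ι} g(x − n)² = 1`. [cite: Dimock2004QED3TorusII, §3.1 p.20 L82–84] -/
theorem tsum_g_sq (x : ι → ℝ) : ∑' n : ι → ℤ, g (x - fun μ => (n μ : ℝ)) ^ 2 = 1 := (hasSum_g_sq x).tsum_eq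

/-- `g` has compact support (inside the closed sup-ball of radius `2∕3`). [cite: Dimock2004QED3TorusII, §3.1 p.20 L82–84] -/
theorem hasCompactSupport_g : HasCompactSupport (g : (ι → ℝ) → ℝ) := by
  refine HasCompactSupport.intro (isCompact_closedBall (0 : ι → ℝ) (2 / 3)) fun x hx => ?_
  apply g_eq_zero
  rw [mem_closedBall, dist_zero_right, not_le] at hx
  exact hx

/-- the derivative of `g` is bounded — the input «`‖g′‖ ≤ G`» of the tree's `QED3CommutatorBounds` ((145)∕(150):
`sup_x|∂h_□(x)| ≤ O(L^{k−i}∕M₀)`) is available for this `g` (continuity of the derivative and compact support; the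
constant is not computed). [cite: Dimock2004QED3TorusII, §3.2 (145) p.24 L25–27, (150) p.24 L52–55] -/
theorem exists_fderiv_g_le : ∃ G : ℝ, ∀ x : ι → ℝ, ‖fderiv ℝ (g : (ι → ℝ) → ℝ) x‖ ≤ G := by
  have h1 : ContDiff ℝ ((1 : ℕ∞) : WithTop ℕ∞) (g : (ι → ℝ) → ℝ) := contDiff_g
  have hc : Continuous (fderiv ℝ (g : (ι → ℝ) → ℝ)) := ContDiff.continuous_fderiv h1 (by norm_num)
  have hs : HasCompactSupport (fderiv ℝ (g : (ι → ℝ) → ℝ)) :=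
    HasCompactSupport.fderiv (𝕜 := ℝ) hasCompactSupport_g
  exact Continuous.bounded_above_of_compact_support hc hs

/-- **THE EXISTENCE STATEMENT OF THE PAPER**: *"a smooth function `g` on `ℝ³` so `g` has support in `{x : |x| ≤ 2∕3}` and
`g = 1` on `{x : |x| ≤ 1∕3}` and `Σ_{n∈ℤ³} g(x − n)² = 1`"* — in every dimension, sup norm.
[cite: Dimock2004QED3TorusII, §3.1 p.20 L82–84] -/
theorem exists_dimock124 (ι : Type*) [Fintype ι] :
    ∃ g : (ι → ℝ) → ℝ, ContDiff ℝ ((⊤ : ℕ∞) : WithTop ℕ∞) g ∧ (∀ x, 2 / 3 < ‖x‖ → g x = 0) ∧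
      (∀ x, ‖x‖ ≤ 1 / 3 → g x = 1) ∧ (∀ x, HasSum (fun n : ι → ℤ => g (x - fun μ => (n μ : ℝ)) ^ 2) 1) ∧
      ∃ G : ℝ, ∀ x, ‖fderiv ℝ g x‖ ≤ G :=
  ⟨g, contDiff_g, fun _ h => g_eq_zero h, fun _ h => g_eq_one h, hasSum_g_sq, exists_fderiv_g_le⟩

/-! ## §3 (124)–(125) on a single scale -/

/-- **(124) `h_□(x) = g((x − y)L^{k−i}∕M₀)`** for the block centred at `y`, scale factor `s = L^{k−i}∕M₀`.
[cite: Dimock2004QED3TorusII, §3.1 (124) p.20 L85–93] -/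
def hBlock (s : ℝ) (y x : ι → ℝ) : ℝ := g (s • (x - y))

/-- the support of `h_□`: `h_□(x) = 0` unless `‖x − y‖ ≤ (2∕3)s^{−1}` — «`supp h_□ ⊂ □̃`» for `s = L^{k−i}∕M₀`.
[cite: Dimock2004QED3TorusII, §3.1 (124), (126) p.20 L85 – p.21 L15 («We have supp h_□ ⊂ □̃»)] -/
theorem hBlock_eq_zero {s : ℝ} (hs : 0 < s) {y x : ι → ℝ} (h : 2 / 3 < s * ‖x - y‖) : hBlock s y x = 0 := by
  apply g_eq_zero
  rwa [norm_smul, Real.norm_eq_abs, abs_of_pos hs]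

/-- **(125) on one scale**: with the blocks of scale `s^{−1}` centred on the lattice `y₀ + s^{−1}ℤ^ι`,
`Σ_{n∈ℤ^ι} h_{□_n}(x)² = 1` for every `x` (`□_n` centred at `y₀ + s^{−1}n`) — *"for `x` well inside `⋃_{□∈D_i}□`,
`Σ_□ h_□(x)² = 1`"*. [cite: Dimock2004QED3TorusII, §3.1 (125) p.21 L1–4] -/
theorem eq125 {s : ℝ} (hs : s ≠ 0) (y₀ x : ι → ℝ) :
    HasSum (fun n : ι → ℤ => hBlock s (y₀ + s⁻¹ • fun μ => (n μ : ℝ)) x ^ 2) 1 := by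
  have e : ∀ n : ι → ℤ, hBlock s (y₀ + s⁻¹ • fun μ => (n μ : ℝ)) x = g (s • (x - y₀) - fun μ => (n μ : ℝ)) := by
    intro n
    rw [hBlock]
    congr 1
    funext μ
    simp only [Pi.smul_apply, Pi.sub_apply, Pi.add_apply, smul_eq_mul]
    field_simp
    ring
  simp_rw [e]
  exact hasSum_g_sq (s • (x - y₀))

end Product

end QED3SquarePartition

end Literature.MathematicalPhysics.QuantumFieldTheory.Dimock2011to13
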